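import Literature.NumberTheory.EllipticCurves.TakahashiDegreeFormulaCoprimeProofs
import Literature.NumberTheory.Automorphic.BrandtEigenvectorDegreeZero
import Literature.NumberTheory.Automorphic.BrandtMatrixDegree
import Summits.ABC.ABC.Theorems.DefiniteXiDefiniteRTControlPrimeOfTakahashi
import HarnessLib

/-!
# `stub_takahashi` · ideator k3 · gen 22 — FAMILY 3: unwinding the typed dictionary leaf

Companion of `Cruxes/DefiniteRTControlPrime/STUB-IDEAS-stub_takahashi-3.md` (gen 22).
Crux `stmt-ABC-11338` = `DefiniteXi.DefiniteRTControlPrime`; registered stub (fixed, untouched):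
`theorem stub_takahashi : takahashi2001_thm_2_3_of_coprime`.

What is typed here (statements as `def … : Prop`, glue proved; NO `sorry`):
* H22.1 `SharpAt w φ δ c` — the NUMERICAL sharp form of Takahashi's Thm 2.3 in one Brandt setup:
  with `ι₀ := gcd { Σ_i w_i φ_i y_i : Σ y_i = 0 }` (the degree-zero Brandt index of the
  eigen-generator `φ`; = `gcd_{a<b} (w_a φ_a − w_b φ_b)`, the `i_r` column of the k3-g12 census),
  `∃ j, j·ι₀ = c ∧ j²·ξ = δ·c` (⇔ `ι₀ ∣ c ∧ δ·ι₀² = ξ·c`), written without a gcd.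
* H22.2 `DictAt w L δ c` — the five clauses of the tree's dictionary leaf
  (`takahashi2001_characterGroupDictionary`, body of `Lines/TakahashiLeaves.lean` stub 2) over an
  abstract weighted lattice.
* H22.3 `DictOfSharp` — the M-sized ℤ-lattice lemma: `SharpAt ∧ φ ∈ L ∧ deg φ = 0 ∧ 0 < c → DictAt`,
  witness `X := ℤ[Cls O]⁰ = ker deg`, `pb a := (a·j)•φ`, `pf y := j·⟨φ,y⟩_w / c`.
* H22.4 `TakahashiSharpCoprime` — the instance-level numerical leaf (named-fact candidate).
* H22.5 `FactOfSharp` — XS arithmetic: `SharpAt` (+ a line generator) gives the fact's `∃ i j` clauses.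
* glue: `charDict_of_dictOfSharp` (H22.3 + tree degree-zero ⇒ (rank-one line form ∧ H22.4 → H_D)),
  stated; `crux_of_fact` proved by name.
-/

set_option linter.dupNamespace false

noncomputable section

namespace Summit.ABC.ABC.Cruxes.DefiniteRTControlPrime.StubIdeas3G22

open scoped BigOperators
open Literature.NumberTheory.EllipticCurves Literature.NumberTheory.EllipticCurves.ModularForms
open Literature.NumberTheory.Automorphic

section Abstract

variable {ι : Type} [Fintype ι]

/-- **H22.1** — sharp numerical form of Takahashi 2001 Thm 2.3 in one weighted Brandt lattice
(`w` = weights, `φ` = a generator of the `a(E)`-eigen-line, `δ` = optimal degree, `c = ord_r Δ_min`):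
there is `j` (`= j_r = #coker(Φ_r(J) → Φ_r(E))`) with `j·⟨φ, X₀⟩_w = c ℤ` and `j²·ξ = δ·c`,
where `X₀ = {y : Σ y_i = 0}` and `ξ = Σ w_i φ_i²`.  Equivalent to `ι₀ ∣ c ∧ δ·ι₀² = ξ·c` with
`ι₀ = gcd ⟨φ, X₀⟩_w` (k3-g12 census column `i_r`; 55/55 + 16/16 + j018422 rows).
[cite: Takahashi2001, Thm. 2.3 (p. 79), p. 84] [cite: Ribet1990, §3] -/
def SharpAt (w : ι → ℕ) (φ : ι → ℤ) (δ c : ℕ) : Prop :=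
  ∃ j : ℕ,
    (∀ y : ι → ℤ, ∑ i, y i = 0 → (c : ℤ) ∣ (j : ℤ) * ∑ i, (w i : ℤ) * φ i * y i) ∧
    (∃ y : ι → ℤ, ∑ i, y i = 0 ∧ (j : ℤ) * ∑ i, (w i : ℤ) * φ i * y i = c) ∧
    j ^ 2 * ∑ i, w i * (φ i).natAbs ^ 2 = δ * c

/-- **H22.2** — the dictionary clauses of `takahashi2001_characterGroupDictionary` /
`Lines/TakahashiLeaves.lean` stub 2, over an abstract lattice `ℤ^ι` with weights `w`, eigen-lattice
`L`, degree `δ` and component order `c`. [cite: ConradStein2001, Thm. 6.1, §7.1] -/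
def DictAt (w : ι → ℕ) (L : Submodule ℤ (ι → ℤ)) (δ c : ℕ) : Prop :=
  ∃ (X : Submodule ℤ (ι → ℤ)) (pb : ℤ →ₗ[ℤ] X) (pf : X →ₗ[ℤ] ℤ),
    (∀ (a : ℤ) (y : X), ∑ i, (w i : ℤ) * (pb a : ι → ℤ) i * (y : ι → ℤ) i = (c : ℤ) * a * pf y) ∧
    (∀ a : ℤ, pf (pb a) = (δ : ℤ) * a) ∧
    Function.Surjective pf ∧
    (∀ (m : ℤ) (v : ι → ℤ), m ≠ 0 → m • v ∈ X → v ∈ X) ∧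
    (pb 1 : ι → ℤ) ∈ L

end Abstract

/-- **H22.3** (M, one prover cycle, pure ℤ-lattice algebra — the load-bearing helper): the sharp
numerical form realises the dictionary with the CANONICAL witness `X := ker (deg) = ℤ[Cls O]⁰`
(saturated as a kernel), `pb a := (a·j) • φ` (in `X` because `deg φ = 0`, in `L` because `φ ∈ L`),
`pf y := j·⟨φ, y⟩_w / c` (integral by clause 1 of `SharpAt`, onto by clause 2, `pf (pb a) = δ a`
by clause 3, adjunction `Σ w (pb a) y = c·a·pf y` by construction). [folklore] -/
def DictOfSharp : Prop :=
  ∀ (ι : Type) [Fintype ι] (w : ι → ℕ) (L : Submodule ℤ (ι → ℤ)) (φ : ι → ℤ) (δ c : ℕ),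
    0 < c → φ ∈ L → ∑ i, φ i = 0 → SharpAt w φ δ c → DictAt w L δ c

/-- **H22.5** (XS arithmetic): from `SharpAt` with `0 < c`, the fact's clauses with `i := c / j`:
`0 < i`, `i·j = c`, `i ∣ ξ` (clause 1 at `y = φ`, using `deg φ = 0`), `δ·i = ξ·j` (clause 3). [folklore] -/
def FactClausesOfSharp : Prop :=
  ∀ (ι : Type) [Fintype ι] (w : ι → ℕ) (φ : ι → ℤ) (δ c : ℕ),
    0 < c → ∑ i, φ i = 0 → SharpAt w φ δ c →
      ∃ i j : ℕ, 0 < i ∧ i * j = c ∧ i ∣ ∑ k, w k * (φ k).natAbs ^ 2 ∧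
        δ * i = (∑ k, w k * (φ k).natAbs ^ 2) * j

/-- **H22.4** — `TakahashiSharpCoprime`, the instance-level NUMERICAL leaf (named-fact candidate,
row-by-row decidable): for the optimal `W` of conductor `M r` (`r` prime, `gcd(M, r) = 1`), every
Brandt setup `S` of type `(M, r)` and every generator `φ` of the `a(W)`-eigen-line,
`SharpAt (w_S) φ δ (ord_r Δ_min W)`.  Geometric content: `i_r = ι₀(S, φ)` and `j_r² ξ = δ c_r`
(Takahashi Thm 2.3 read through Grothendieck `Φ_r(J) = X^∨/u(X)` and Ribet/Kohel `X_r(J₀(rM)) ≅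
(ℤ[Cls O]⁰, ⟨,⟩_w)`). [cite: Takahashi2001, Thm. 2.3 (p. 79), Prop. 1.1, p. 84]
[cite: ConradStein2001, Thm. 6.1, §7.1] [cite: Kohel2001, Thm. 4.3] -/
def TakahashiSharpCoprime : Prop :=
  ∀ (W : WeierstrassCurve ℚ) [W.IsElliptic] (M r : ℕ) [NeZero (M * r)],
    r.Prime → M.Coprime r → W.conductorNorm ℤ = M * r →
    ∀ P : ModularParametrizationData W (M * r),
      (∀ (W' : WeierstrassCurve ℚ) [W'.IsElliptic], W'.conductorNorm ℤ = M * r →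
          ∀ P' : ModularParametrizationData W' (M * r),
          P'.f = P.f → P.modularDegree ≤ P'.modularDegree) →
      ∀ (S : Brandt.XiSetup M r) [Fintype (Brandt.ClassSet S.O)] (φ : Brandt.ClassSet S.O → ℤ),
        φ ≠ 0 →
        Brandt.eigenLattice (M * r) (Brandt.matrix S.O) (fun n => W.LFunction n) = ℤ ∙ φ →
        SharpAt (Brandt.weight S.O) φ P.modularDegree
          ((W.minimalDiscriminantNorm ℤ).factorization r)

/-- `H_R` in LINE form (∃ generator), the shape `Brandt.xi_eq_sum` and H22.3 consume; equivalent to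
the `finrank = 1` form of `Lines/TakahashiLeaves.lean` stub 1 by saturation of the eigen-lattice
(`Brandt.mem_eigenLattice_of_smul_mem`). [cite: Pizer1980, Thm. 2.28] [cite: Takahashi2001, §2 p. 78] -/
def RankOneLineCoprime : Prop :=
  ∀ (W : WeierstrassCurve ℚ) [W.IsElliptic] (M r : ℕ) [NeZero (M * r)],
    r.Prime → M.Coprime r → W.conductorNorm ℤ = M * r →
    ∀ (_P : ModularParametrizationData W (M * r)) (S : Brandt.XiSetup M r)
      [Fintype (Brandt.ClassSet S.O)],
      ∃ φ : Brandt.ClassSet S.O → ℤ, φ ≠ 0 ∧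
        Brandt.eigenLattice (M * r) (Brandt.matrix S.O) (fun n => W.LFunction n) = ℤ ∙ φ

/-- `H_D` at coprime level, body VERBATIM `Lines/TakahashiLeaves.lean` stub 2 /
k1-g25 `takahashi2001_characterGroupDictionary_of_coprime`. [cite: ConradStein2001, Thm. 6.1, §7.1] -/
def CharDictCoprime : Prop :=
  ∀ (W : WeierstrassCurve ℚ) [W.IsElliptic] (M r : ℕ) [NeZero (M * r)],
    r.Prime → M.Coprime r → W.conductorNorm ℤ = M * r →
    ∀ P : ModularParametrizationData W (M * r),
      (∀ (W' : WeierstrassCurve ℚ) [W'.IsElliptic], W'.conductorNorm ℤ = M * r →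
          ∀ P' : ModularParametrizationData W' (M * r),
          P'.f = P.f → P.modularDegree ≤ P'.modularDegree) →
      ∀ (S : Brandt.XiSetup M r) [Fintype (Brandt.ClassSet S.O)],
        DictAt (Brandt.weight S.O)
          (Brandt.eigenLattice (M * r) (Brandt.matrix S.O) (fun n => W.LFunction n))
          P.modularDegree ((W.minimalDiscriminantNorm ℤ).factorization r)

/-- **Degree zero is a tree theorem** (D1 of the sheet): every vector of the `a(W)`-eigen-lattice of
a Brandt setup has `Σ φ_i = 0` — column sums `σ₁(p) = p + 1` (`XiSetup.sum_matrix_eq_sigma`,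
PROVED) and Hasse (`sum_eq_zero_of_mem_eigenLattice_lFunction`, PROVED). PROVED here, no sorry. -/
theorem deg_eq_zero_of_mem_eigenLattice {M r : ℕ} [NeZero (M * r)] (S : Brandt.XiSetup M r)
    [Fintype (Brandt.ClassSet S.O)] (W : WeierstrassCurve ℚ) [W.IsElliptic]
    {φ : Brandt.ClassSet S.O → ℤ}
    (hφ : φ ∈ Brandt.eigenLattice (M * r) (Brandt.matrix S.O) (fun n => W.LFunction n)) :
    ∑ i, φ i = 0 := by
  obtain ⟨p, hp, hpN⟩ : ∃ p : ℕ, p.Prime ∧ ¬ p ∣ M * r := by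
    obtain ⟨p, hlt, hp⟩ := Nat.exists_infinite_primes (M * r + 1)
    refine ⟨p, hp, fun h => ?_⟩
    have := Nat.le_of_dvd (Nat.pos_of_ne_zero (NeZero.ne _)) h
    omega
  refine Brandt.sum_eq_zero_of_mem_eigenLattice_lFunction W hφ hp hpN fun j => ?_
  have hcop : Nat.Coprime p (M * r) := (Nat.Prime.coprime_iff_not_dvd hp).mpr hpN
  rw [S.sum_matrix_eq_sigma hp.ne_zero hcop j, ArithmeticFunction.sigma_one_apply,
    Nat.Prime.sum_divisors hp]
  push_cast
  ring

/-- **`c_r > 0`** at a prime of the conductor is needed by H22.3; recorded as the instance-level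
hypothesis shape (tree: multiplicative reduction at `r ∥ N` gives `ord_r Δ_min ≥ 1`). Statement only. -/
def OrdMinimalDiscriminantPos : Prop :=
  ∀ (W : WeierstrassCurve ℚ) [W.IsElliptic] (M r : ℕ) [NeZero (M * r)],
    r.Prime → M.Coprime r → W.conductorNorm ℤ = M * r →
      0 < (W.minimalDiscriminantNorm ℤ).factorization r

/-- **Glue G1** (S once H22.3 is proved): the dictionary leaf from the numerical leaf.
`RankOneLineCoprime ∧ TakahashiSharpCoprime ∧ DictOfSharp ∧ OrdMinimalDiscriminantPos → CharDictCoprime`,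
PROVED (degree zero from `deg_eq_zero_of_mem_eigenLattice`). -/
theorem charDict_of_sharp (hD : DictOfSharp) (hc : OrdMinimalDiscriminantPos)
    (hR : RankOneLineCoprime) (hS : TakahashiSharpCoprime) : CharDictCoprime := by
  intro W _ M r _ hr hcop hN P hmin S _
  obtain ⟨φ, hφ0, hL⟩ := hR W M r hr hcop hN P S
  have hmem : φ ∈ Brandt.eigenLattice (M * r) (Brandt.matrix S.O) (fun n => W.LFunction n) := by
    rw [hL]; exact Submodule.mem_span_singleton_self φ
  exact hD _ (Brandt.weight S.O) _ φ _ _ (hc W M r hr hcop hN) hmem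
    (deg_eq_zero_of_mem_eigenLattice S W hmem) (hS W M r hr hcop hN P hmin S φ hφ0 hL)

/-- **Glue G2** (the stub's statement from the numerical leaves, through the tree bridge
`takahashi2001_thm_2_3_of_coprime_of_brandtDictionary_one'`): PROVED modulo the Prop hypotheses. -/
theorem fact_of_sharp (hD : DictOfSharp) (hc : OrdMinimalDiscriminantPos)
    (hR : RankOneLineCoprime) (hS : TakahashiSharpCoprime) :
    takahashi2001_thm_2_3_of_coprime := by
  have hDict := charDict_of_sharp hD hc hR hS
  refine takahashi2001_thm_2_3_of_coprime_of_brandtDictionary_one' ?_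
  intro W _ M r _ hr hcop hN P hmin hne
  obtain ⟨S₀⟩ := hne
  classical
  letI : Fintype (Brandt.ClassSet S₀.O) := Fintype.ofFinite _
  obtain ⟨X, pb, pf, hadj, hδ, hsurj, hXsat, hmemb⟩ := hDict W M r hr hcop hN P hmin S₀
  obtain ⟨φ, hφ0, hL⟩ := hR W M r hr hcop hN P S₀
  have hrank : Module.finrank ℤ
      (Brandt.eigenLattice (M * r) (Brandt.matrix S₀.O) (fun n => W.LFunction n)) = 1 := by
    rw [hL, finrank_span_set_eq_card (R := ℤ)
      ((linearIndepOn_singleton_iff ℤ (v := id)).mpr hφ0)]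
    simp
  exact ⟨S₀, inferInstance, X, pb, pf, hadj, hδ, hsurj, hXsat, hrank, hmemb⟩

/-- **G3** (landed, by name): the crux from the stub's statement. -/
theorem crux_of_fact (h : takahashi2001_thm_2_3_of_coprime) :
    Summit.ABC.ABC.Theses.DefiniteXi.DefiniteRTControlPrime :=
  Summit.ABC.ABC.Theorems.DefiniteRTControlPrime.definiteRTControlPrime_of_takahashi h

end Summit.ABC.ABC.Cruxes.DefiniteRTControlPrime.StubIdeas3G22

end
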